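import Summits.BirchSwinnertonDyer.BirchSwinnertonDyer.Theorems.ClassRecordThreeEulerHalvesAtThreeShimuraInertSavingDisplayOfLabels
import HarnessLib

/-!
# Kolyvagin's ORDER bound at `p = 3` on the UNRAMIFIED locus, 1/3: the leaf and the unit-index end (Cartan road, T2 port)

bsd-idea-10 g9 (ideator, lens = transfer; `--supports stmt-BirchSwinnertonDyer-19109 --as helper`). The tree's D7
`ShimuraKolyvaginOfImage.padicValNat_card_sha_three_primary_add_le_of_shimuraLabels_of_irr_of_casselsTate_of_divLab`
(`…ShimuraInertSavingDisplayOfLabels`) is keyed to the EICHLER locus: every bad prime off the inert set `S` SPLITS in `K`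
(`hsp`) and `3 ∈ S`. On the CARTAN locus of the non-split Cartan road (crux `EulerHalvesAtThree`, child item 23422; workfile
`Cruxes/EulerHalvesAtThree/Lines/cartan_display.lean`, stub `stub_cartanOrderMachineAtThree`) the primes of the Cartan set are
inert and UNRAMIFIED with `q² ∥ N`, so `hsp` fails — but D7's proof chain consumes `hsp` at exactly ONE leaf (the Kodaira–Néron
exponent bound at the multiplicative places off `S`, via «split ⇒ unramified»). This port re-keys the chain to the unramified clause.
Nothing here is new mathematics: every proof is the tree's, re-keyed; CONDITIONAL on `casselsTate_levelInputs K` exactly as D7.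
No summit statement, no route crux and no item is proved by these files.

FILE MAP of the port (three files, ≤ 400 lines each; this is file 1/3):
* 1/3 `…CartanUnramifiedShiftEnd` — §1 the leaf on the unramified locus (`kodairaSymbolAt_and_ordMinimalDiscriminant_baseChange_eq_of_unramified`,
  `padicValNat_ordMinimalDiscriminant_le_of_unramified`: A233 along an unramified place, Silverman VII.5.4 (a), under
  `hunr : ∀ ℓ ∣ N, ℓ ∉ S → ℓ ∤ d_K` instead of the split clause `hsp`) and §2 the unit-index end (`Ш = 0`, `Nat.card` form) of
  `…KolyImageUnitEndShift` VERBATIM with the binder `hsp` replaced by the leaf's CONCLUSION `hbd` (suffix `_of_discBound`);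
* 2/3 `…CartanUnramifiedOrderIndexDiv` — §3 McCallum's refined ORDER entry (`…KolyImageOrderEntryEndShiftDiv` Part Two) and §4 the
  INDEX form (`…KolyImageIndexFormEndDiv`), both VERBATIM with `hsp ↦ hbd` (suffix `_of_discBound`);
* 3/3 `…CartanOrderMachineUnramified` — §5 the image inputs from `Irr E[3]` under «every prime of `N` unramified in `K`» and D7
  re-assembled (`…of_divLab_of_unramified`, binders `hin`, `hunr`, `3 ∤ d_K`), §6 the closed form `cartanOrderMachineAtThree` =
  the statement of `stub_cartanOrderMachineAtThree` of `Cruxes/EulerHalvesAtThree/Lines/cartan_display.lean` VERBATIM, proved.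
[cite: McCallumLMS1991, §1 Theorem (Kolyvagin), §4 Cor. 4.5, Lemma 5.1, Cor. 5.6] [cite: GrossLMS1991, §2, §9 (PDF p. 227), Prop. 9.3, §10]
[cite: SilvermanAEC2009, Prop. VII.5.4 (a), Thm. VII.6.1] [cite: Jetchev2008, Thm. 1.1, (1), Cor. 1.5]
[cite: MilneADT2006, Ch. I Thm. 4.10(b), Thm. 6.13(a)] [cite: NeukirchANT1999, Ch. III Thm. (2.12) and Cor.]
presearch: «Kolyvagin order bound for CM points on Shimura curves with non-split (unramified) level» → [corpus:
book:burns2007-l-functions-galois-representations p0536–p0538 (Nekovář 2007, Thm. 3.2), p0559 (2.6.3)] [galaxy: panama:260103219445847]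
— finiteness in print for any Shimura curve and CM point; the ORDER-with-index form only in the tree (D7, Eichler locus).
beyond-print theorem: no (re-keying of tree proofs).
-/

noncomputable section

open scoped Classical Pointwise AddSubgroup

set_option linter.dupNamespace false

namespace Summit.BirchSwinnertonDyer.BirchSwinnertonDyer.Theorems

section Leaf

open WeierstrassCurve NumberField IsDedekindDomain Field Function
  Literature.NumberTheory.EllipticCurves Literature.NumberTheory.EllipticCurves.KolyvaginCocycle
  Literature.NumberTheory.EllipticCurves.RingClassField
  Literature.NumberTheory.GaloisRepresentations Literature.NumberTheory.NumberFields
  Literature.NumberTheory.GaloisCohomology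
  Literature.NumberTheory.DiophantineGeometry
  Summit.BirchSwinnertonDyer.Rank1Residual.X11b
  Summit.BirchSwinnertonDyer.Rank1Residual.X11b.Three.GrossBadPlace
  Summit.BirchSwinnertonDyer.BirchSwinnertonDyer.Theorems.ShimuraKolyvaginLocalShift

variable {K : Type} [Field K] [NumberField K]

/-! ### §1 The leaf on the unramified locus: Tate's algorithm along an unramified place (A233) -/

/-- **(UNRAMIFIED LOCUS) At a bad place `w` of `E/K` over a prime `ℓ ∉ S` with `ℓ ∤ d_K`, `w | ℓ` is unramified
and Tate's algorithm over `K_w = ℚ_ℓ` is that of `E/ℚ`.** For `E = W/ℚ` elliptic of conductor `N`,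
`K` quadratic, the crux's clause `hsp` (`ℓ` prime, `ℓ ∣ N`, `ℓ ∉ S ⇒ #primesOver = 2`) and a place `w`
of `K` of bad reduction whose rational prime `ℓ` is not in `S`: `ℓ ∣ N` (good reduction ascends,
`hasGoodReductionAt_baseChange_of_hasGoodReductionAt_rat`; the conductor detects bad reduction,
`dvd_conductorNorm_iff`), so `ℓ` splits, `e(w|ℓ) = 1` (x11b3's `isUnramifiedIn_of_ncard_primesOver_eq_two`),
and by the tree's theorem A233 (`UnramifiedBaseChange.kodairaSymbolAt_baseChange_of_ramificationIdx_eq_one_holds`,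
Silverman VII.5.4 (a)) the Kodaira symbol and `ord Δ_min` of `E/K` at `w` are those of `E/ℚ` at `ℓ`,
the latter being `ord_ℓ` of the global minimal discriminant (`ordMinimalDiscriminant_eq_padicValInt`).
[cite: SilvermanAEC2009, Prop. VII.5.4 (a), VIII.8] -/
theorem kodairaSymbolAt_and_ordMinimalDiscriminant_baseChange_eq_of_unramified
    (_hK : IsImaginaryQuadratic K) (W : WeierstrassCurve ℚ) [W.IsElliptic] [W.IsGloballyMinimal]
    {N : ℕ} (hN : W.conductorNorm ℤ = N) {S : Finset ℕ}
    (hunr : ∀ ℓ : ℕ, ℓ.Prime → ℓ ∣ N → ℓ ∉ S → ¬ (ℓ : ℤ) ∣ NumberField.discr K)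
    (w : HeightOneSpectrum (𝓞 K)) (hw : ¬ (W.baseChange K).HasGoodReductionAt w)
    (hℓS : ((Rat.HeightOneSpectrum.primesEquiv (w.under (𝓞 ℚ)) : ℕ)) ∉ S) :
    (W.baseChange K).kodairaSymbolAt w = W.kodairaSymbolAt (w.under (𝓞 ℚ)) ∧
      (W.baseChange K).ordMinimalDiscriminant w =
        padicValInt (Rat.HeightOneSpectrum.primesEquiv (w.under (𝓞 ℚ)) : ℕ) W.minimalDiscriminantInt ∧
      ¬ W.HasGoodReductionAt (w.under (𝓞 ℚ)) := by
  set v : HeightOneSpectrum (𝓞 ℚ) := w.under (𝓞 ℚ) with hvdef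
  haveI hlo : w.asIdeal.LiesOver v.asIdeal := ⟨rfl⟩
  set ℓ : ℕ := (Rat.HeightOneSpectrum.primesEquiv v : ℕ) with hℓdef
  have hℓP : ℓ.Prime := (Rat.HeightOneSpectrum.primesEquiv v).2
  haveI : Fact ℓ.Prime := ⟨hℓP⟩
  -- `v` is bad for `E/ℚ`, so `ℓ ∣ N`
  have hbadv : ¬ W.HasGoodReductionAt v := fun h ↦
    hw (hasGoodReductionAt_baseChange_of_hasGoodReductionAt_rat W v w h)
  have hℓN : ℓ ∣ N := by rw [← hN]; exact (W.dvd_conductorNorm_iff v).mpr hbadv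
  -- `ℓ` splits in `K`, hence `e(w | v) = 1`
  have hℓv : (ℓ : 𝓞 ℚ) ∈ v.asIdeal :=
    (natCast_mem_asIdeal_iff_eq_primesEquiv_symm v hℓP).mpr (Equiv.symm_apply_apply _ v).symm
  have hunrv : Algebra.IsUnramifiedIn (𝓞 K) v.asIdeal :=
    ShimuraKolyvaginOfImage.isUnramifiedIn_rat_of_not_dvd_discr K hℓP (hunr ℓ hℓP hℓN hℓS) v hℓv
  have he : w.asIdeal.ramificationIdx (𝓞 ℚ) = 1 :=
    (Algebra.isUnramifiedIn_iff_forall_ramificationIdx_eq_one.mp hunrv) w.asIdeal hlo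
  -- A233 along the unramified `w | v`
  haveI : PerfectField (IsLocalRing.ResidueField (v.adicCompletionIntegers ℚ)) :=
    PerfectField.ofFinite
  haveI : Finite (IsLocalRing.ResidueField (w.adicCompletionIntegers K)) :=
    HeightOneSpectrum.finite_residueField_adicCompletionIntegers K w
  haveI : PerfectField (IsLocalRing.ResidueField (w.adicCompletionIntegers K)) :=
    PerfectField.ofFinite
  have hc : (algebraMap ℚ K).comp (algebraMap (𝓞 ℚ) ℚ) =
      (algebraMap (𝓞 K) K).comp (algebraMap (𝓞 ℚ) (𝓞 K)) := by
    rw [← IsScalarTower.algebraMap_eq, ← IsScalarTower.algebraMap_eq]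
  have hwv : w.asIdeal.under (𝓞 ℚ) = v.asIdeal := rfl
  have hA := UnramifiedBaseChange.kodairaSymbolAt_baseChange_of_ramificationIdx_eq_one_holds K v w W
    hc hwv (KolyvaginHloc.not_map_le_sq_of_ramificationIdx_eq_one' hwv he)
  refine ⟨hA.1, ?_, hbadv⟩
  rw [hA.2]
  exact LocalTorsionMult.ordMinimalDiscriminant_eq_padicValInt W v rfl

/-- **(UNRAMIFIED LOCUS) `v_p(ord_w Δ_min(E/K)) ≤ 1 + Σ_{ℓ ∣ N} v_p(ord_ℓ Δ_min(E/ℚ))` at every multiplicative place `w` of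
`E/K` over a prime `ℓ ∉ S`.** On the locus of item 19718 every bad prime `ℓ ∉ S` splits in `K` (`hsp`), so
`w | ℓ` is unramified and `ord_w Δ_min(E/K) = ord_ℓ Δ_min(E/ℚ)` (A233, `…InertLocalAll` §3); `ℓ ∣ N`
because the conductor detects bad reduction. Hence the depth `k₀ = 1 + Σ_{ℓ ∣ N} v_p(ord_ℓ Δ_min(E/ℚ))`
serves as the `k` of shim3a's level-shift lemma uniformly in `w`. [cite: SilvermanAEC2009, Prop. VII.5.4 (a),
Thm. VII.6.1] -/
theorem padicValNat_ordMinimalDiscriminant_le_of_unramified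
    (hK : IsImaginaryQuadratic K) (W : WeierstrassCurve ℚ) [W.IsElliptic] [W.IsGloballyMinimal]
    {N : ℕ} [NeZero N] (hN : W.conductorNorm ℤ = N) (p : ℕ) {S : Finset ℕ}
    (hunr : ∀ ℓ : ℕ, ℓ.Prime → ℓ ∣ N → ℓ ∉ S → ¬ (ℓ : ℤ) ∣ NumberField.discr K)
    (w : HeightOneSpectrum (𝓞 K)) (hmw : (W.baseChange K).HasMultiplicativeReductionAt w)
    (hℓS : ((Rat.HeightOneSpectrum.primesEquiv (w.under (𝓞 ℚ)) : ℕ)) ∉ S) :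
    padicValNat p ((W.baseChange K).ordMinimalDiscriminant w) ≤
      1 + ∑ q ∈ N.primeFactors, padicValNat p (padicValInt q W.minimalDiscriminantInt) := by
  haveI : (W.baseChange K).IsElliptic := inferInstanceAs (W.map (algebraMap ℚ K)).IsElliptic
  obtain ⟨-, hord, hbadv⟩ := kodairaSymbolAt_and_ordMinimalDiscriminant_baseChange_eq_of_unramified hK W hN
    hunr w hmw.not_hasGoodReductionAt hℓS
  rw [hord]
  set ℓ : ℕ := (Rat.HeightOneSpectrum.primesEquiv (w.under (𝓞 ℚ)) : ℕ) with hℓdef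
  have hℓP : ℓ.Prime := (Rat.HeightOneSpectrum.primesEquiv (w.under (𝓞 ℚ))).2
  have hℓN : ℓ ∣ N := by rw [← hN]; exact (W.dvd_conductorNorm_iff (w.under (𝓞 ℚ))).mpr hbadv
  have hmem : ℓ ∈ N.primeFactors := Nat.mem_primeFactors.mpr ⟨hℓP, hℓN, NeZero.ne N⟩
  have hle : padicValNat p (padicValInt ℓ W.minimalDiscriminantInt) ≤
      ∑ q ∈ N.primeFactors, padicValNat p (padicValInt q W.minimalDiscriminantInt) :=
    Finset.single_le_sum (f := fun q ↦ padicValNat p (padicValInt q W.minimalDiscriminantInt))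
      (fun _ _ ↦ Nat.zero_le _) hmem
  omega

end Leaf

end Summit.BirchSwinnertonDyer.BirchSwinnertonDyer.Theorems

namespace Summit.BirchSwinnertonDyer.BirchSwinnertonDyer.Theorems.ShimuraKolyvaginOfImage

section UnitEnd

open Summit.BirchSwinnertonDyer.BirchSwinnertonDyer.Theorems.ShimuraKolyvaginLocalShift

open WeierstrassCurve NumberField IsDedekindDomain Field Function
  Literature.NumberTheory.EllipticCurves Literature.NumberTheory.EllipticCurves.KolyvaginCocycle
  Literature.NumberTheory.EllipticCurves.RingClassField
  Literature.NumberTheory.GaloisRepresentations Literature.NumberTheory.NumberFields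
  Literature.NumberTheory.GaloisCohomology
  Summit.BirchSwinnertonDyer.Rank1Residual.X11b
  Summit.BirchSwinnertonDyer.BirchSwinnertonDyer.Theorems.ShimuraKolyvaginLocalShift

variable {K : Type} [Field K] [NumberField K]

/-! ### §2 `Ш(E/K)[p^∞] = 0` at unit index, keyed to the exponent bound `hbd` (port of `…KolyImageUnitEndShift`) -/

/-- **[PORT (bsd-idea-10 g9): the split clause `hsp` of the tree original is REPLACED by the Kodaira–Néron exponent bound `hbd` it was only used to produce; proof otherwise VERBATIM.]** **`Ш(E/K)[p^∞] = 0` on the locus of item 19718 from `P ∉ pE(K)`, the RING-CLASS-RATIONAL Euler-system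
carrier read at depth `k`, and Kolyvagin reciprocity — with NO Tamagawa clause.** Binders: the crux's `W`
(globally minimal, conductor `N`), `p` odd with the four image inputs (hIz) (hIs) (hIc) (hIt) (in place of `p ≥ 5`, `ρ̄_{E,p}` onto), `K` imaginary quadratic with `ι : K → ℂ`,
the inert set `S` with the crux's clauses `hin` ∕ `hsp` VERBATIM; a non-torsion `P ∈ E(K)` with `p ∤ P` in
`E(K)`; `hpointsRk` — for EVERY depth `k` and every `M ≥ 1`: a sign `ε`, a lift `τ` of `c`, modules
`A_m ≤ E(K̄)` admissible for `p^M` AND for `p^{M+k}` (printed: `A_m = E(K[m])`, no `p`-torsion at all,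
Gross Lemma 4.3), `K`-embeddings `emb m : K[m] → K̄` with every point of `A_m` rational over `emb m (K[m])`
(Gross (4.1), BD96 §2.3–2.5), points `P_m ∈ A_m` invariant modulo `p^M` with `P_1 = P`, and, for the
square-free products `m` of Kolyvagin primes with `Frob = Frob(∞)` on `E[p^{M+k}]`: `P_m` invariant modulo
`p^{M+k}` (McCallum (4) at depth `M + k`: `a_ℓ ≡ ℓ + 1 ≡ 0 mod p^{M+k}`), Gross 5.4 (1) (eigen relation
modulo `p^M A_m`) and McCallum 4.4 at `λ ∣ m` for the LEVEL-`p^M` classes; plus (R)_M `hR` at the level-`M`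
Kolyvagin primes. Conclusion: every element of `Ш(E/K)` killed by a power of `p` is `0`. Proof: file III's
`sha_primary_eq_zero_at_of_pointsM_shift_of_reciprocityM_of_not_dvd_of_conductorNorm_ofImage` at the depth
`k₀ = 1 + Σ_{ℓ ∣ N} v_p(ord_ℓ Δ_min(E/ℚ))`, the Selmer clause (d) at EVERY `v ∤ m` being shim3a's LEVEL-SHIFT
lemma `ShimuraKolyvaginLocalShift.kolyvaginClass_mem_selmerLocalKer_of_ringClassRational_shift` with §1.
Compared with `…InertMachineEntry` §4 (`sha_primary_eq_zero_of_ringClassRationalPointsM`, g7): the clause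
`hTam` is DELETED, the carrier is read one notch deeper. HONEST: this is S1 of the skeleton MODULO (a) the
Shimura Euler-system carrier in this currency (BD96 §2, Nekovář 2007 (4.8)–(4.13) — printed, not in the
tree), (b) (R)_M (from Poitou–Tate, `…InertReciprocity` §1), (c) the index guard of the `Nat.card` form
below; item 19718 and S1 ∕ S2 stay OPEN. [cite: GrossLMS1991, §1 Thm. 1.3 (2), Prop. 2.1 (2), §§3–8, §10]
[cite: McCallumLMS1991, §1, §§4–5, Lemma 4.6] [cite: BertoliniDarmon1996, §2.3–2.6, Prop. 2.6]
[cite: Howard2004Duke, Thm. 3.2.2 (proof)] [cite: Kim2022HigherGZ, §2.1 and Thm. 4.3] -/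
theorem sha_primary_eq_zero_of_ringClassRationalPointsM_shift_ofImage_of_discBound
    (W : WeierstrassCurve ℚ) [W.IsElliptic] [W.IsGloballyMinimal] {N : ℕ} [NeZero N]
    (hN : W.conductorNorm ℤ = N) {p : ℕ} (hp : p.Prime) (hp2 : p ≠ 2)
    (hIz : ∃ z : absoluteGaloisGroup K, ∀ t : geomTorsion (W.baseChange K) p, z • t = -t)
    (hIs : (W.baseChange K).HasIrreducibleModPGaloisRep p)
    (hIc : ∀ f : geomTorsion (W.baseChange K) p →+ geomTorsion (W.baseChange K) p,
      (∀ (g : absoluteGaloisGroup K) (t : geomTorsion (W.baseChange K) p), f (g • t) = g • f t) →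
        ∃ k : ℤ, ∀ t, f t = k • t)
    (hIt : AddSubgroup.torsionBy (W.baseChange K).toAffine.Point (p : ℤ) = ⊥) (hK : IsImaginaryQuadratic K) (ι : K →+* ℂ)
    {S : Finset ℕ}
    (hin : ∀ ℓ ∈ S, ℓ.Prime ∧ ℓ ∣ N ∧ ¬ ℓ ^ 2 ∣ N ∧
      ((Ideal.span {(ℓ : ℤ)}).primesOver (𝓞 K)).ncard = 1 ∧ ¬ (ℓ : ℤ) ∣ NumberField.discr K)
    (hbd : ∀ w : IsDedekindDomain.HeightOneSpectrum (𝓞 K), (W.baseChange K).HasMultiplicativeReductionAt w →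
      ((Rat.HeightOneSpectrum.primesEquiv (w.under (𝓞 ℚ)) : ℕ)) ∉ S →
      padicValNat p ((W.baseChange K).ordMinimalDiscriminant w) ≤
        1 + ∑ q ∈ N.primeFactors, padicValNat p (padicValInt q W.minimalDiscriminantInt))
    {P : (W.baseChange K).toAffine.Point} (hnt : ¬ IsOfFinAddOrder P)
    (hndvd : ∀ Q : (W.baseChange K).toAffine.Point, p • Q ≠ P)
    (hpointsRk : ∀ (k : ℕ) {M : ℕ} (_hM : 1 ≤ M)
      (hdiv : ∀ Q : geomPoints (W.baseChange K), ∃ R, ((p ^ M : ℕ) : ℤ) • R = Q)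
      (c : K ≃ₐ[ℚ] K) (_hc : c ≠ 1),
      ∃ (ε : ℤ) (τ : AlgebraicClosure K ≃+* AlgebraicClosure K) (hτ : IsLiftOfAut c τ)
        (A : ℕ → AddSubgroup (geomPoints (W.baseChange K)))
        (hA : ∀ m, KolyvaginCocycle.IsAdmissible (Field.absoluteGaloisGroup K) (A m)
          ((p ^ M : ℕ) : ℤ))
        (emb : ∀ m : ℕ, ringClassField K ι m →ₐ[K] AlgebraicClosure K)
        (Pt : ℕ → geomPoints (W.baseChange K))
        (hPt : ∀ m, Pt m ∈
          KolyvaginCocycle.invPoints (Field.absoluteGaloisGroup K) (A m) ((p ^ M : ℕ) : ℤ)),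
        (ε = 1 ∨ ε = -1) ∧
        IsOfFinAddOrder (Affine.Point.map (W' := W) (c : K →ₐ[ℚ] K) P - ε • P) ∧
        (∀ m, ∀ a ∈ A m, hτ.pointsMap W a ∈ A m) ∧
        Pt 1 = toGeomPoints (W.baseChange K) P ∧
        (∀ m, m ≠ 0 → ∀ a ∈ A m, ∀ Φ : Field.absoluteGaloisGroup K,
          (∀ x : ringClassField K ι m, Φ • emb m x = emb m x) → Φ • a = a) ∧
        (∀ m, KolyvaginCocycle.IsAdmissible (Field.absoluteGaloisGroup K) (A m)
          ((p ^ (M + k) : ℕ) : ℤ)) ∧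
        (∀ m : ℕ, Squarefree m →
          (∀ q ∈ m.primeFactors, IsKolyvaginPrime N W K p q ∧ FrobEqFrobInfty W K (p ^ (M + k)) q) →
          Pt m ∈ KolyvaginCocycle.invPoints (Field.absoluteGaloisGroup K) (A m)
            ((p ^ (M + k) : ℕ) : ℤ) ∧
          (∃ B ∈ A m, hτ.pointsMap W (Pt m) =
            (ε * (-1) ^ m.primeFactors.card) • Pt m + ((p ^ M : ℕ) : ℤ) • B) ∧
          (∀ ℓ : ℕ, ℓ.Prime → ℓ ∣ m → ∀ v : HeightOneSpectrum (𝓞 K), (ℓ : 𝓞 K) ∈ v.asIdeal →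
            ∀ a : ℕ, (((p : ℤ) ^ a) •
                kolyvaginClass (W.baseChange K) _ hdiv (hA m) (Pt m) (hPt m) ∈
                selmerLocalKer (W.baseChange K) (v.adicCompletion K) ((p ^ M : ℕ) : ℤ) ↔
              ((p : ℤ) ^ a) • kolyvaginClass (W.baseChange K) _ hdiv (hA (m / ℓ)) (Pt (m / ℓ))
                  (hPt (m / ℓ)) ∈
                (W.baseChange K).torsionLocalKer (v.adicCompletion K) ((p ^ M : ℕ) : ℤ)))))
    (hR : ∀ {M : ℕ} (_hM : 1 ≤ M) {ℓ : ℕ} (hℓ : IsKolyvaginPrime N W K p ℓ),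
      FrobEqFrobInfty W K (p ^ M) ℓ →
      ∃ (A : Type) (_ : AddCommGroup A)
        (e : geomTorsion (W.baseChange K) ((p ^ M : ℕ) : ℤ) →+
          geomTorsion (W.baseChange K) ((p ^ M : ℕ) : ℤ) →+ A),
        (∀ x, e x x = 0) ∧ (∀ x, (∀ y, e x y = 0) → x = 0) ∧
        ∀ s ∈ selmerGroup (W.baseChange K) ((p ^ M : ℕ) : ℤ),
          ∀ c' : galH1Torsion (W.baseChange K) ((p ^ M : ℕ) : ℤ),
          (∀ v : HeightOneSpectrum (𝓞 K), (ℓ : 𝓞 K) ∉ v.asIdeal →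
            c' ∈ selmerLocalKer (W.baseChange K) (v.adicCompletion K) ((p ^ M : ℕ) : ℤ)) →
          (∀ w : InfinitePlace K,
            c' ∈ selmerLocalKer (W.baseChange K) w.Completion ((p ^ M : ℕ) : ℤ)) →
          ∀ 𝔔 ∈ hℓ.place.primesAbove, ∀ F : Field.absoluteGaloisGroup K,
            IsArithFrobAt (𝓞 K) F 𝔔 →
            F ∈ torsionFixing (W.baseChange K) ((p ^ M : ℕ) : ℤ) →
            ∀ σ ∈ 𝔔.inertia (Field.absoluteGaloisGroup K),
            e (h1Eval (W.baseChange K) ((p ^ M : ℕ) : ℤ) s F)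
              (h1Eval (W.baseChange K) ((p ^ M : ℕ) : ℤ) c' σ) = 0) :
    ∀ d : (W.baseChange K).sha, (∃ j : ℕ, p ^ j • d = 0) → d = 0 := by
  haveI : (W.baseChange K).IsElliptic := inferInstanceAs (W.map (algebraMap ℚ K)).IsElliptic
  -- the depth `k₀` absorbing the `p`-parts of all Kodaira–Néron exponents on the locus
  set k₀ : ℕ := 1 + ∑ q ∈ N.primeFactors, padicValNat p (padicValInt q W.minimalDiscriminantInt) with hk₀
  have hk1 : 1 ≤ k₀ := Nat.le_add_right 1 _
  have hkm : ∀ w : HeightOneSpectrum (𝓞 K), (W.baseChange K).HasMultiplicativeReductionAt w →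
      ((Rat.HeightOneSpectrum.primesEquiv (w.under (𝓞 ℚ)) : ℕ)) ∉ S →
      padicValNat p ((W.baseChange K).ordMinimalDiscriminant w) ≤ k₀ := fun w hmw hℓS ↦
    hbd w hmw hℓS
  refine sha_primary_eq_zero_at_of_pointsM_shift_of_reciprocityM_of_not_dvd_of_conductorNorm_ofImage W hN hK hnt
    hp hp2 hIz hIs hIc hIt k₀ hndvd ?_ hR
  intro M hM hdiv c hc
  obtain ⟨ε, τ, hτ, A, hA, emb, Pt, hPt, hε, h53, hAτ, hPt1, hrat, hAk, hm'⟩ := hpointsRk k₀ hM hdiv c hc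
  refine ⟨ε, τ, hτ, A, hA, Pt, hPt, hε, h53, hAτ, hPt1, fun m hm hk ↦
    ⟨(hm' m hm hk).2.1, ?_, (hm' m hm hk).2.2⟩⟩
  intro v hv
  have hm0 : m ≠ 0 := Squarefree.ne_zero hm
  exact kolyvaginClass_mem_selmerLocalKer_of_ringClassRational_shift hK ι hm0 (emb m) W hp hp2 hin hk1
    hkm (fun q hq ↦ (hk q hq).1.2.1) (hA m) (hAk m) (hrat m hm0) (hPt m) ((hm' m hm hk).1) v hv

/-- **[PORT (bsd-idea-10 g9): the split clause `hsp` of the tree original is REPLACED by the Kodaira–Néron exponent bound `hbd` it was only used to produce; proof otherwise VERBATIM.]** **S1's conclusion `#Ш(E/K)[p^∞] ≤ p^{2·ord_p[E(K):ℤP]}` (here `= 1`) on the locus of item 19718, from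
the depth-`k` ring-class-rational Euler-system data and the Poitou–Tate named fact — WITHOUT the Tamagawa
clause.** Binders: the crux's (`W` globally minimal of conductor `N`, `[Fact p.Prime]`, `p ≠ 2`, the four image inputs
(hIz) (hIs) (hIc) (hIt), `K` imaginary quadratic, `hin`, `hsp`) + `ι : K → ℂ` + `P ∈ E(K)` non-torsion with
`padicValNat p [E(K):ℤP] = 0` AND the guard `0 < [E(K):ℤP]` + `hpointsRk` (§2) + `hPT` (Poitou–Tate,
cite-only named fact, conjunct 14 of `PublishedInputsFive` ⇒ this theorem is CONDITIONAL on it). Proof: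
(R)_M from `kolyvaginReciprocityM_of_poitouTate_of_conductorNorm` (p471634 §1), `P ∉ pE(K)` from
`nsmul_ne_of_padicValNat_index_eq_zero` (p471634 §2), `Ш(E/K)[p^∞] = 0` from §2; the `p`-primary component
is `⊥`. This is g7's `natCard_primaryComponent_sha_le_of_ringClassRationalPointsM_of_poitouTate` with the
hypothesis `hTam` DELETED (planner g28: the level shift makes the Tamagawa clause dead weight). HONEST: S1
stays OPEN — the gap to its registered signature is now exactly {`hpointsRk` (printed carrier, read one
notch deeper), `hPT`, `0 < index`}; S1's data `Dt X W' P₀ degS` + GZ display are not used.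
[cite: GrossLMS1991, Prop. 2.1 (2)] [cite: McCallumLMS1991, §1 Theorem (Kolyvagin), Lemma 4.6, Lemma 5.1]
[cite: MilneADT2006, Ch. I Thm. 4.10(b)] [cite: Howard2004Duke, Thm. 3.2.2 (proof)] -/
theorem natCard_primaryComponent_sha_le_of_ringClassRationalPointsM_shift_of_poitouTate_ofImage_of_discBound
    (hPT : poitouTate_sum_localTatePairing_eq_zero K)
    (W : WeierstrassCurve ℚ) [W.IsElliptic] [W.IsGloballyMinimal] {N : ℕ} [NeZero N]
    (hN : W.conductorNorm ℤ = N) {p : ℕ} [Fact p.Prime] (hp2 : p ≠ 2)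
    (hIz : ∃ z : absoluteGaloisGroup K, ∀ t : geomTorsion (W.baseChange K) p, z • t = -t)
    (hIs : (W.baseChange K).HasIrreducibleModPGaloisRep p)
    (hIc : ∀ f : geomTorsion (W.baseChange K) p →+ geomTorsion (W.baseChange K) p,
      (∀ (g : absoluteGaloisGroup K) (t : geomTorsion (W.baseChange K) p), f (g • t) = g • f t) →
        ∃ k : ℤ, ∀ t, f t = k • t)
    (hIt : AddSubgroup.torsionBy (W.baseChange K).toAffine.Point (p : ℤ) = ⊥) (hK : IsImaginaryQuadratic K) (ι : K →+* ℂ)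
    {S : Finset ℕ}
    (hin : ∀ ℓ ∈ S, ℓ.Prime ∧ ℓ ∣ N ∧ ¬ ℓ ^ 2 ∣ N ∧
      ((Ideal.span {(ℓ : ℤ)}).primesOver (𝓞 K)).ncard = 1 ∧ ¬ (ℓ : ℤ) ∣ NumberField.discr K)
    (hbd : ∀ w : IsDedekindDomain.HeightOneSpectrum (𝓞 K), (W.baseChange K).HasMultiplicativeReductionAt w →
      ((Rat.HeightOneSpectrum.primesEquiv (w.under (𝓞 ℚ)) : ℕ)) ∉ S →
      padicValNat p ((W.baseChange K).ordMinimalDiscriminant w) ≤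
        1 + ∑ q ∈ N.primeFactors, padicValNat p (padicValInt q W.minimalDiscriminantInt))
    {P : (W.baseChange K).toAffine.Point} (hnt : ¬ IsOfFinAddOrder P)
    (hidx0 : 0 < (AddSubgroup.zmultiples P).index)
    (hidx : padicValNat p (AddSubgroup.zmultiples P).index = 0)
    (hpointsRk : ∀ (k : ℕ) {M : ℕ} (_hM : 1 ≤ M)
      (hdiv : ∀ Q : geomPoints (W.baseChange K), ∃ R, ((p ^ M : ℕ) : ℤ) • R = Q)
      (c : K ≃ₐ[ℚ] K) (_hc : c ≠ 1),
      ∃ (ε : ℤ) (τ : AlgebraicClosure K ≃+* AlgebraicClosure K) (hτ : IsLiftOfAut c τ)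
        (A : ℕ → AddSubgroup (geomPoints (W.baseChange K)))
        (hA : ∀ m, KolyvaginCocycle.IsAdmissible (Field.absoluteGaloisGroup K) (A m)
          ((p ^ M : ℕ) : ℤ))
        (emb : ∀ m : ℕ, ringClassField K ι m →ₐ[K] AlgebraicClosure K)
        (Pt : ℕ → geomPoints (W.baseChange K))
        (hPt : ∀ m, Pt m ∈
          KolyvaginCocycle.invPoints (Field.absoluteGaloisGroup K) (A m) ((p ^ M : ℕ) : ℤ)),
        (ε = 1 ∨ ε = -1) ∧
        IsOfFinAddOrder (Affine.Point.map (W' := W) (c : K →ₐ[ℚ] K) P - ε • P) ∧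
        (∀ m, ∀ a ∈ A m, hτ.pointsMap W a ∈ A m) ∧
        Pt 1 = toGeomPoints (W.baseChange K) P ∧
        (∀ m, m ≠ 0 → ∀ a ∈ A m, ∀ Φ : Field.absoluteGaloisGroup K,
          (∀ x : ringClassField K ι m, Φ • emb m x = emb m x) → Φ • a = a) ∧
        (∀ m, KolyvaginCocycle.IsAdmissible (Field.absoluteGaloisGroup K) (A m)
          ((p ^ (M + k) : ℕ) : ℤ)) ∧
        (∀ m : ℕ, Squarefree m →
          (∀ q ∈ m.primeFactors, IsKolyvaginPrime N W K p q ∧ FrobEqFrobInfty W K (p ^ (M + k)) q) →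
          Pt m ∈ KolyvaginCocycle.invPoints (Field.absoluteGaloisGroup K) (A m)
            ((p ^ (M + k) : ℕ) : ℤ) ∧
          (∃ B ∈ A m, hτ.pointsMap W (Pt m) =
            (ε * (-1) ^ m.primeFactors.card) • Pt m + ((p ^ M : ℕ) : ℤ) • B) ∧
          (∀ ℓ : ℕ, ℓ.Prime → ℓ ∣ m → ∀ v : HeightOneSpectrum (𝓞 K), (ℓ : 𝓞 K) ∈ v.asIdeal →
            ∀ a : ℕ, (((p : ℤ) ^ a) •
                kolyvaginClass (W.baseChange K) _ hdiv (hA m) (Pt m) (hPt m) ∈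
                selmerLocalKer (W.baseChange K) (v.adicCompletion K) ((p ^ M : ℕ) : ℤ) ↔
              ((p : ℤ) ^ a) • kolyvaginClass (W.baseChange K) _ hdiv (hA (m / ℓ)) (Pt (m / ℓ))
                  (hPt (m / ℓ)) ∈
                (W.baseChange K).torsionLocalKer (v.adicCompletion K) ((p ^ M : ℕ) : ℤ))))) :
    Nat.card (AddCommGroup.primaryComponent (W.baseChange K).sha p) ≤
      p ^ (2 * padicValNat p (AddSubgroup.zmultiples P).index) := by
  have hp : p.Prime := Fact.out
  have hndvd : ∀ Q : (W.baseChange K).toAffine.Point, p • Q ≠ P :=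
    nsmul_ne_of_padicValNat_index_eq_zero hnt hp hidx0 hidx
  have h0 := sha_primary_eq_zero_of_ringClassRationalPointsM_shift_ofImage_of_discBound W hN hp hp2 hIz hIs hIc hIt hK ι hin hbd hnt hndvd
    hpointsRk (@fun _ hM _ hℓ _ ↦ kolyvaginReciprocityM_of_poitouTate_of_conductorNorm W hN hPT hp hM hℓ)
  have hbot : AddCommGroup.primaryComponent (W.baseChange K).sha p = ⊥ := by
    refine (AddSubgroup.eq_bot_iff_forall _).mpr fun x hx ↦ ?_
    obtain ⟨n, hn⟩ := (AddCommGroup.mem_primaryComponent).1 hx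
    exact h0 x ⟨n, hn⟩
  rw [hbot, AddSubgroup.card_bot, hidx, mul_zero, pow_zero]

end UnitEnd

end Summit.BirchSwinnertonDyer.BirchSwinnertonDyer.Theorems.ShimuraKolyvaginOfImage

end
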